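import Mathlib
import HarnessLib

/-!
# The coefficient matrix of a double Taylor sum in blown-up coordinates

(Line `janus-bands`, crux `ArrangementNormalForm`, stub `stub_separateTwoPos_hI`, part
`HIAlgebra`.) Pure algebra for the local analysis of the Taylor pieces at a point of the base
plane. In blown-up coordinates `(t, v)` on a thin sector adjacent to a ray, a double Taylor sum
`∑ c(i,m) ξ^m λ^i` of the numerator (`ξ = x̃ − x̃_P`, `λ = ỹ − ℓ(x̃)`) becomes
`F(t, u) = ∑_{im ∈ T} κ im · t^{i+m} · u^{π im}` with `u = s + σ v` (`s` the slope of the ray,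
`σ = ±1` the side, `π` = the exponent of the transversal coordinate). This file provides:
the matrix `cmat` with `F(t, s + σ v) = ∑_{a,b ≤ d} cmat a b t^a v^b` (`usum_eq_cmat`, the input
format of `separateTwo_monoSplitGlue`); its vanishing below the order `a₀` of the sum and a
non-zero entry in row `a₀` (`cmat_eq_zero_of_lt`, `exists_cmat_ne_zero`, registered as
`separateTwo_hiAlgebra`); the diagonal structure at `s = 0` (`cmat_zero_ne_zero`); the bounds
`|piece| ≤ C t^{a₀}` and `|piece| ≤ ∑ |κ| t^{i+m} v^{π}`; the order `a₀` itself (`exists_order`);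
and the binomial re-centring of the `λ`-expansion at a point off the pole line (`recentre`,
`exists_recentre_ne_zero`).
-/

noncomputable section

open Polynomial Finset

namespace Summit.KontsevichZagierPeriods.ArrangementNormalForm.JanusBands

namespace SepTwo

variable (T : Finset (ℕ × ℕ)) (κ : ℕ × ℕ → ℝ) (π : ℕ × ℕ → ℕ)

/-- The polynomial in the transversal variable `u` collecting the terms of `t`-degree `a`. -/
def upoly (a : ℕ) : ℝ[X] := ∑ im ∈ T, if im.1 + im.2 = a then C (κ im) * X ^ (π im) else 0

/-- The same in the angular variable `v`, `u = s + σ v`. -/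
def vpoly (s σ : ℝ) (a : ℕ) : ℝ[X] := (upoly T κ π a).comp (C s + C σ * X)

/-- The `(t, v)`-coefficient matrix of size `d + 1`. -/
def cmat (s σ : ℝ) (d : ℕ) : Fin (d + 1) → Fin (d + 1) → ℝ :=
  fun a b => (vpoly T κ π s σ a).coeff b

/-- The double sum `F(t, u) = ∑ κ im · t^{i+m} · u^{π im}`. -/
def usum (t u : ℝ) : ℝ := ∑ im ∈ T, κ im * t ^ (im.1 + im.2) * u ^ (π im)

/-- Evaluation of `upoly`. -/
theorem eval_upoly (a : ℕ) (u : ℝ) :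
    (upoly T κ π a).eval u = ∑ im ∈ T, if im.1 + im.2 = a then κ im * u ^ (π im) else 0 := by
  unfold upoly
  rw [eval_finsetSum]
  refine Finset.sum_congr rfl fun im _ => ?_
  split_ifs <;> simp

/-- Evaluation of `vpoly`. -/
theorem eval_vpoly (s σ : ℝ) (a : ℕ) (v : ℝ) :
    (vpoly T κ π s σ a).eval v = (upoly T κ π a).eval (s + σ * v) := by
  simp [vpoly, eval_comp]

/-- `F(t, u) = ∑ₐ t^a · upolyₐ(u)`. -/
theorem usum_eq_sum_upoly (A : ℕ) (hA : ∀ im ∈ T, im.1 + im.2 < A) (t u : ℝ) :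
    usum T κ π t u = ∑ a ∈ range A, t ^ a * (upoly T κ π a).eval u := by
  simp_rw [eval_upoly, Finset.mul_sum]
  rw [Finset.sum_comm]
  unfold usum
  refine Finset.sum_congr rfl fun im him => ?_
  have h : ∀ a ∈ range A, t ^ a * (if im.1 + im.2 = a then κ im * u ^ (π im) else 0) =
      if im.1 + im.2 = a then t ^ (im.1 + im.2) * (κ im * u ^ (π im)) else 0 := by
    intro a _
    split_ifs with h
    · rw [h]
    · rw [mul_zero]
  rw [Finset.sum_congr rfl h, Finset.sum_ite_eq, if_pos (Finset.mem_range.2 (hA im him))]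
  ring

/-- Degree bound for `upoly`. -/
theorem natDegree_upoly_le (a d : ℕ) (hπ : ∀ im ∈ T, π im ≤ d) :
    (upoly T κ π a).natDegree ≤ d := by
  unfold upoly
  refine natDegree_sum_le_of_forall_le _ _ fun im him => ?_
  split_ifs
  · exact (natDegree_C_mul_X_pow_le _ _).trans (hπ im him)
  · simp

/-- Degree bound for `vpoly`. -/
theorem natDegree_vpoly_lt (s σ : ℝ) (a d : ℕ) (hπ : ∀ im ∈ T, π im ≤ d) :
    (vpoly T κ π s σ a).natDegree < d + 1 := by
  unfold vpoly
  have h1 : (C s + C σ * X : ℝ[X]).natDegree ≤ 1 := by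
    refine (natDegree_add_le _ _).trans (max_le (by simp) ?_)
    exact (natDegree_C_mul_le _ _).trans natDegree_X_le
  calc ((upoly T κ π a).comp (C s + C σ * X)).natDegree
      ≤ (upoly T κ π a).natDegree * (C s + C σ * X : ℝ[X]).natDegree := natDegree_comp_le
    _ ≤ d * 1 := Nat.mul_le_mul (natDegree_upoly_le T κ π a d hπ) h1
    _ < d + 1 := by omega

/-- **The matrix representation** `F(t, s + σ v) = ∑_{a,b ≤ d} cmat a b t^a v^b`. -/
theorem usum_eq_cmat (d : ℕ) (hdeg : ∀ im ∈ T, im.1 + im.2 ≤ d) (hπ : ∀ im ∈ T, π im ≤ d)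
    (s σ t v : ℝ) :
    usum T κ π t (s + σ * v) =
      ∑ a : Fin (d + 1), ∑ b : Fin (d + 1), cmat T κ π s σ d a b * t ^ (a : ℕ) * v ^ (b : ℕ) := by
  rw [usum_eq_sum_upoly T κ π (d + 1) (fun im him => Nat.lt_succ_of_le (hdeg im him)),
    ← Fin.sum_univ_eq_sum_range]
  refine Finset.sum_congr rfl fun a _ => ?_
  rw [← eval_vpoly, eval_eq_sum_range' (natDegree_vpoly_lt T κ π s σ a d hπ),
    ← Fin.sum_univ_eq_sum_range, Finset.mul_sum]
  refine Finset.sum_congr rfl fun b _ => ?_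
  unfold cmat
  ring

/-- Below the order, `upoly` vanishes. -/
theorem upoly_eq_zero_of_lt {a₀ a : ℕ} (h : ∀ im ∈ T, κ im ≠ 0 → a₀ ≤ im.1 + im.2)
    (ha : a < a₀) : upoly T κ π a = 0 := by
  unfold upoly
  refine Finset.sum_eq_zero fun im him => ?_
  split_ifs with he
  · have : κ im = 0 := by
      by_contra hne
      have := h im him hne
      omega
    simp [this]
  · rfl

/-- **Below the order, the matrix vanishes.** -/
theorem cmat_eq_zero_of_lt {a₀ : ℕ} (h : ∀ im ∈ T, κ im ≠ 0 → a₀ ≤ im.1 + im.2) (s σ : ℝ)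
    (d : ℕ) (a b : Fin (d + 1)) (ha : (a : ℕ) < a₀) : cmat T κ π s σ d a b = 0 := by
  unfold cmat vpoly
  rw [upoly_eq_zero_of_lt T κ π h ha, zero_comp, coeff_zero]

/-- The coefficient of `upoly` at an exponent hit by exactly one term. -/
theorem coeff_upoly_of_inj {a₀ : ℕ} {im₀ : ℕ × ℕ} (him₀ : im₀ ∈ T) (ha : im₀.1 + im₀.2 = a₀)
    (hinj : ∀ im ∈ T, im.1 + im.2 = a₀ → π im = π im₀ → im = im₀) :
    (upoly T κ π a₀).coeff (π im₀) = κ im₀ := by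
  unfold upoly
  rw [finsetSum_coeff, Finset.sum_eq_single im₀]
  · simp [ha]
  · intro im him hne
    split_ifs with he
    · rw [coeff_C_mul, coeff_X_pow, if_neg, mul_zero]
      intro hπ
      exact hne (hinj im him he hπ.symm)
    · exact coeff_zero _
  · intro h; exact absurd him₀ h

/-- **A non-zero entry in the row of the order.** -/
theorem exists_cmat_ne_zero {a₀ : ℕ} {im₀ : ℕ × ℕ} (him₀ : im₀ ∈ T) (h0 : κ im₀ ≠ 0)
    (ha : im₀.1 + im₀.2 = a₀)
    (hinj : ∀ im ∈ T, im.1 + im.2 = a₀ → π im = π im₀ → im = im₀) {s σ : ℝ} (hσ : σ ≠ 0)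
    (d : ℕ) (hd : a₀ < d + 1) (hπ : ∀ im ∈ T, π im ≤ d) :
    ∃ b : Fin (d + 1), cmat T κ π s σ d ⟨a₀, hd⟩ b ≠ 0 := by
  have hu : upoly T κ π a₀ ≠ 0 := fun h => by
    have := coeff_upoly_of_inj T κ π him₀ ha hinj
    rw [h, coeff_zero] at this
    exact h0 this.symm
  have hv : vpoly T κ π s σ a₀ ≠ 0 := by
    unfold vpoly
    rw [Ne, comp_eq_zero_iff, not_or]
    refine ⟨hu, fun ⟨_, hq⟩ => hσ ?_⟩
    have h1 := congr_arg (fun p : ℝ[X] => p.coeff 1) hq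
    simp only [coeff_add, coeff_C_succ, coeff_C_mul, coeff_X_one, mul_one, zero_add] at h1
    exact h1
  obtain ⟨n, hn⟩ : ∃ n, (vpoly T κ π s σ a₀).coeff n ≠ 0 := by
    by_contra hall
    push Not at hall
    exact hv (Polynomial.ext fun n => by rw [hall n, coeff_zero])
  have hnd : n < d + 1 :=
    lt_of_le_of_lt (le_natDegree_of_ne_zero hn) (natDegree_vpoly_lt T κ π s σ a₀ d hπ)
  exact ⟨⟨n, hnd⟩, hn⟩

/-- At the slope `s = 0` the matrix is the `u`-coefficient up to a sign. -/
theorem cmat_zero_eq (σ : ℝ) (d : ℕ) (a b : Fin (d + 1)) :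
    cmat T κ π 0 σ d a b = (upoly T κ π a).coeff b * σ ^ (b : ℕ) := by
  unfold cmat vpoly
  rw [map_zero, zero_add, comp_C_mul_X_coeff]

/-- **Diagonal structure at `s = 0`:** the monomial of every non-zero term of the double sum has
a non-zero matrix entry. -/
theorem cmat_zero_ne_zero {im₀ : ℕ × ℕ} (him₀ : im₀ ∈ T) (h0 : κ im₀ ≠ 0)
    (hinj : ∀ im ∈ T, im.1 + im.2 = im₀.1 + im₀.2 → π im = π im₀ → im = im₀) {σ : ℝ}
    (hσ : σ ≠ 0) (d : ℕ) (hd : im₀.1 + im₀.2 < d + 1) (hπd : π im₀ < d + 1) :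
    cmat T κ π 0 σ d ⟨im₀.1 + im₀.2, hd⟩ ⟨π im₀, hπd⟩ ≠ 0 := by
  rw [cmat_zero_eq]
  show (upoly T κ π (im₀.1 + im₀.2)).coeff (π im₀) * σ ^ π im₀ ≠ 0
  rw [coeff_upoly_of_inj T κ π him₀ rfl hinj]
  exact mul_ne_zero h0 (pow_ne_zero _ hσ)

/-- **The order bound** `|F'(t, u)| ≤ (∑ |κ| 3^π) t^{a₀}` for a sub-sum `T' ⊆ T`, `0 ≤ t ≤ 1`,
`|u| ≤ 3`. -/
theorem abs_usum_le {a₀ : ℕ} (T' : Finset (ℕ × ℕ)) (h : ∀ im ∈ T', κ im ≠ 0 → a₀ ≤ im.1 + im.2)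
    {t u : ℝ} (ht0 : 0 ≤ t) (ht1 : t ≤ 1) (hu : |u| ≤ 3) :
    |usum T' κ π t u| ≤ (∑ im ∈ T', |κ im| * 3 ^ (π im)) * t ^ a₀ := by
  unfold usum
  rw [Finset.sum_mul]
  refine (Finset.abs_sum_le_sum_abs _ _).trans (Finset.sum_le_sum fun im him => ?_)
  by_cases hk : κ im = 0
  · simp [hk]
  rw [abs_mul, abs_mul, abs_pow, abs_pow, abs_of_nonneg ht0]
  have h1 : t ^ (im.1 + im.2) ≤ t ^ a₀ := pow_le_pow_of_le_one ht0 ht1 (h im him hk)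
  have h2 : |u| ^ (π im) ≤ 3 ^ (π im) := pow_le_pow_left₀ (abs_nonneg _) hu _
  calc |κ im| * t ^ (im.1 + im.2) * |u| ^ π im ≤ |κ im| * t ^ a₀ * 3 ^ π im :=
        mul_le_mul (mul_le_mul_of_nonneg_left h1 (abs_nonneg _)) h2 (by positivity)
          (by positivity)
    _ = |κ im| * 3 ^ π im * t ^ a₀ := by ring

/-- **The diagonal bound** `|F'(t, σ v)| ≤ ∑ |κ| t^{i+m} v^{π}` for `|σ| = 1`, `t, v ≥ 0`. -/
theorem abs_usum_le_sum (T' : Finset (ℕ × ℕ)) {σ t v : ℝ} (hσ : |σ| = 1) (ht0 : 0 ≤ t)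
    (hv0 : 0 ≤ v) :
    |usum T' κ π t (σ * v)| ≤ ∑ im ∈ T', |κ im| * (t ^ (im.1 + im.2) * v ^ (π im)) := by
  unfold usum
  refine (Finset.abs_sum_le_sum_abs _ _).trans (le_of_eq (Finset.sum_congr rfl fun im _ => ?_))
  rw [abs_mul, abs_mul, abs_pow, abs_pow, abs_mul, hσ, one_mul, abs_of_nonneg ht0,
    abs_of_nonneg hv0, mul_assoc]

/-- **The order of a double sum with a non-zero coefficient.** -/
theorem exists_order (h : ∃ im ∈ T, κ im ≠ 0) :
    ∃ (a₀ : ℕ) (im₀ : ℕ × ℕ), im₀ ∈ T ∧ κ im₀ ≠ 0 ∧ im₀.1 + im₀.2 = a₀ ∧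
      ∀ im ∈ T, κ im ≠ 0 → a₀ ≤ im.1 + im.2 := by
  classical
  have hne : (T.filter fun im => κ im ≠ 0).Nonempty := by
    obtain ⟨im, him, hk⟩ := h
    exact ⟨im, Finset.mem_filter.2 ⟨him, hk⟩⟩
  obtain ⟨im₀, him₀, hmin⟩ := Finset.exists_min_image _ (fun im : ℕ × ℕ => im.1 + im.2) hne
  obtain ⟨him₀T, hk₀⟩ := Finset.mem_filter.1 him₀
  exact ⟨im₀.1 + im₀.2, im₀, him₀T, hk₀, rfl, fun im him hk =>
    hmin im (Finset.mem_filter.2 ⟨him, hk⟩)⟩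

/-! ### Re-centring the `λ`-expansion at a point off the pole line -/

/-- The re-centred coefficients: `∑ᵢ cc(i,m) (η₁ + λ')^i = ∑ⱼ rc(j,m) λ'^j`. -/
def recentre (N : ℕ) (cc : ℕ × ℕ → ℝ) (η₁ : ℝ) (jm : ℕ × ℕ) : ℝ :=
  ∑ i ∈ range N, if jm.1 ≤ i then (i.choose jm.1 : ℝ) * η₁ ^ (i - jm.1) * cc (i, jm.2) else 0

/-- **Binomial re-centring.** -/
theorem sum_recentre (N N' : ℕ) (cc : ℕ × ℕ → ℝ) (η₁ ξ l : ℝ) :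
    ∑ i ∈ range N, (∑ m ∈ range N', cc (i, m) * ξ ^ m) * (η₁ + l) ^ i =
      ∑ j ∈ range N, (∑ m ∈ range N', recentre N cc η₁ (j, m) * ξ ^ m) * l ^ j := by
  have hbin : ∀ i ∈ range N, (η₁ + l) ^ i =
      ∑ j ∈ range N, if j ≤ i then (i.choose j : ℝ) * η₁ ^ (i - j) * l ^ j else 0 := by
    intro i hi
    have hiN := Finset.mem_range.1 hi
    rw [add_comm, add_pow, ← Finset.sum_filter]
    have hf : (range N).filter (fun j => j ≤ i) = range (i + 1) := by
      ext j; simp only [Finset.mem_filter, Finset.mem_range]; omega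
    rw [hf]
    exact Finset.sum_congr rfl fun j _ => by ring
  calc ∑ i ∈ range N, (∑ m ∈ range N', cc (i, m) * ξ ^ m) * (η₁ + l) ^ i
      = ∑ i ∈ range N, ∑ j ∈ range N, ∑ m ∈ range N', if j ≤ i then
          (i.choose j : ℝ) * η₁ ^ (i - j) * cc (i, m) * ξ ^ m * l ^ j else 0 := by
        refine Finset.sum_congr rfl fun i hi => ?_
        rw [hbin i hi, Finset.mul_sum]
        refine Finset.sum_congr rfl fun j _ => ?_
        split_ifs
        · rw [Finset.sum_mul]
          exact Finset.sum_congr rfl fun m _ => by ring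
        · rw [mul_zero, Finset.sum_const_zero]
    _ = ∑ j ∈ range N, ∑ i ∈ range N, ∑ m ∈ range N', if j ≤ i then
          (i.choose j : ℝ) * η₁ ^ (i - j) * cc (i, m) * ξ ^ m * l ^ j else 0 := Finset.sum_comm
    _ = ∑ j ∈ range N, (∑ m ∈ range N', recentre N cc η₁ (j, m) * ξ ^ m) * l ^ j := by
        refine Finset.sum_congr rfl fun j _ => ?_
        unfold recentre
        rw [Finset.sum_mul, Finset.sum_comm]
        refine Finset.sum_congr rfl fun m _ => ?_
        rw [Finset.sum_mul, Finset.sum_mul]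
        refine Finset.sum_congr rfl fun i _ => ?_
        split_ifs
        · ring
        · rw [zero_mul, zero_mul]

/-- **The re-centred sum has a non-zero coefficient if the original one has.** -/
theorem exists_recentre_ne_zero (N N' : ℕ) (cc : ℕ × ℕ → ℝ) (η₁ : ℝ)
    (h : ∃ im ∈ range N ×ˢ range N', cc im ≠ 0) :
    ∃ jm ∈ range N ×ˢ range N', recentre N cc η₁ jm ≠ 0 := by
  classical
  set S := ((range N ×ˢ range N').filter fun im => cc im ≠ 0).image Prod.fst with hS
  have hne : S.Nonempty := by
    obtain ⟨im, him, hk⟩ := h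
    exact ⟨im.1, Finset.mem_image.2 ⟨im, Finset.mem_filter.2 ⟨him, hk⟩, rfl⟩⟩
  obtain ⟨im₀, him₀, hi₀'⟩ := Finset.mem_image.1 (S.max'_mem hne)
  obtain ⟨him₀T, hk₀⟩ := Finset.mem_filter.1 him₀
  obtain ⟨hi₀N, hm₀N'⟩ := Finset.mem_product.1 him₀T
  refine ⟨im₀, him₀T, ?_⟩
  unfold recentre
  rw [Finset.sum_eq_single im₀.1]
  · simp only [le_refl, if_true, Nat.choose_self, Nat.cast_one, one_mul, Nat.sub_self, pow_zero]
    exact hk₀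
  · intro i hi hne'
    split_ifs with hle
    · have hlt : im₀.1 < i := lt_of_le_of_ne hle (Ne.symm hne')
      have hzero : cc (i, im₀.2) = 0 := by
        by_contra hcc
        have hiS : i ∈ S := Finset.mem_image.2 ⟨(i, im₀.2), Finset.mem_filter.2
          ⟨Finset.mem_product.2 ⟨hi, hm₀N'⟩, hcc⟩, rfl⟩
        have := S.le_max' i hiS
        rw [← hi₀'] at this
        exact absurd this (not_le.2 hlt)
      simp [hzero]
    · rfl
  · intro hi₀
    exact absurd hi₀N hi₀

end SepTwo

/-- **A non-zero entry of the coefficient matrix in the row of the order** (registered part of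
`stub_separateTwoPos_hI`; literal form of `SepTwo.exists_cmat_ne_zero`): if the double sum
`∑_{im ∈ T} κ im t^{im.1+im.2} u^{π im}` has a non-zero coefficient `κ im₀` of total degree `a₀`
and `π` separates the terms of that degree, then for `u = s + σ v`, `σ ≠ 0`, some
`(t, v)`-coefficient `cmat a₀ b` is non-zero. -/
theorem separateTwo_hiAlgebra (T : Finset (ℕ × ℕ)) (κ : ℕ × ℕ → ℝ) (π : ℕ × ℕ → ℕ) (a₀ : ℕ) (im₀ : ℕ × ℕ) (him₀ : im₀ ∈ T) (h0 : κ im₀ ≠ 0) (ha : im₀.1 + im₀.2 = a₀) (hinj : ∀ im ∈ T, im.1 + im.2 = a₀ → π im = π im₀ → im = im₀) (s σ : ℝ) (hσ : σ ≠ 0) (d : ℕ) (hd : a₀ < d + 1) (hπ : ∀ im ∈ T, π im ≤ d) : ∃ b : Fin (d + 1), ((∑ im ∈ T, if im.1 + im.2 = a₀ then Polynomial.C (κ im) * Polynomial.X ^ (π im) else 0).comp (Polynomial.C s + Polynomial.C σ * Polynomial.X)).coeff (b : ℕ) ≠ 0 := by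
  exact SepTwo.exists_cmat_ne_zero T κ π him₀ h0 ha hinj hσ d hd hπ

end Summit.KontsevichZagierPeriods.ArrangementNormalForm.JanusBands
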